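import Summits.SmoothPoincare4.SmoothPoincare4.Theorems.DottedCircleRasmussenDcrGapHelperHandlebodyChartModelHandlesCollar

/-!
# Helper `helper_handlebodyChart_modelHandles` (M3: handle structure of the model dotted handlebody `D_k`)
# of line `mk_friends` for crux `DcrGap` — collar push, part 3: swept angles
(item stmt-SmoothPoincare4-16128, route route-SmoothPoincare4-DottedCircleRasmussen)

**Registered piece `helper_handlebodyChart_modelHandles_collarPhase` of the model lemma M3.**  The collar
push `κ` of `…ModelHandlesCollar.lean` (a diffeomorphism of `ℝ⁴` supported in a given open `U ⊇ D_k`,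
carrying `D_k` into `D_k ∩ {G_k ≤ 24/25}`, commuting with the rotations of the `w`-plane) comes with,
for every hole centre `c_l`, a smooth rotation-invariant real function `SW_l` on a neighbourhood of `D_k`
lifting the angle swept about `c_l` by the planar shadow of the orbit:
`u(z(κ x) - c_l) = e^{i SW_l(x)} u(z(x) - c_l)` on `D_k` (`u(v) = v/|v|`).  These lifts are the form
in which the squeeze of M3 must transport the per-handle twist multiplier
`u_ε(z) = Π_l u(z - c_l)^{ε_l}` (hypothesis `squeeze` of the registered reduction
`helper_handlebodyChart_modelHandles_of_data`); swept angles of composed squeezes add.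

Proof (`ModelHandles.exists_collar_phase`): subdivide the time interval `[0, 1/20]` into `n` steps so
short that consecutive planar shadows of an orbit are closer than `1/2` (velocity bound of the field
times the step), while along orbits of points of `D_k` every hole centre stays at distance `≥ √(1/2)`
(the orbit stays in the half-guard zone); then every ratio of consecutive shadow offsets from `c_l` lies
in the right half-plane, where the principal argument is real-analytic, and `SW_l` is the sum of these
principal arguments — smooth on the open set where the ratios stay in the right half-plane, invariant
because the flow commutes with the rotations (which do not move `z`), and a lift by telescoping.

No definitions, no named facts, no `sorry`.

References: J. Milnor, *Morse Theory* (1963), Thm. 3.1 [Milnor1963].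
-/

-- the prescribed namespace `Summit.<P>.<Sub>.…` duplicates `SmoothPoincare4` (P = Sub)
set_option linter.dupNamespace false
set_option linter.style.longLine false

noncomputable section

open scoped Manifold ContDiff Topology NNReal
open Function Set Metric Filter
open Literature.Topology.FourManifolds Literature.Topology.FourManifolds.MMSW
open Literature.AlgebraicTopology.Homotopy.HopfFibration

namespace Summit.SmoothPoincare4.SmoothPoincare4.Theorems.DcrGap.MkFriends

namespace ModelHandles

/-! ## Swept angles of the collar push -/

/-- `|z(x) - z(y)| ≤ ‖x - y‖`. [folklore] -/
theorem norm_zC_sub_le (x y : EuclideanSpace ℝ (Fin 4)) : ‖zC x - zC y‖ ≤ ‖x - y‖ := by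
  have h : Complex.normSq (zC x - zC y) + Complex.normSq (wC x - wC y) = ‖x - y‖ ^ 2 := by
    rw [norm_sq_eq]; rfl
  have h1 : ‖zC x - zC y‖ ^ 2 ≤ ‖x - y‖ ^ 2 := by
    rw [← Complex.normSq_eq_norm_sq]; nlinarith [Complex.normSq_nonneg (wC x - wC y)]
  exact le_of_pow_le_pow_left₀ two_ne_zero (norm_nonneg _) h1

/-- The argument is real-smooth on the slit plane. [folklore] -/
theorem contDiffAt_arg {z : ℂ} (hz : z ∈ Complex.slitPlane) : ContDiffAt ℝ ∞ Complex.arg z := by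
  have h : Complex.arg = fun z => (Complex.log z).im := funext fun z => (Complex.log_im z).symm
  rw [h]
  exact Complex.imCLM.contDiff.contDiffAt.comp z ((Complex.contDiffAt_log hz).restrict_scalars ℝ)

/-- The unit vector of a product is the product of the unit vectors. [folklore] -/
theorem unit_mul (a b : ℂ) : a * b / ((‖a * b‖ : ℝ) : ℂ) = a / ((‖a‖ : ℝ) : ℂ) * (b / ((‖b‖ : ℝ) : ℂ)) := by
  rw [norm_mul]; push_cast; ring

/-- The unit vector of a nonzero complex number is `exp(i arg)`. [folklore] -/
theorem unit_eq_exp_arg {a : ℂ} (ha : a ≠ 0) : a / ((‖a‖ : ℝ) : ℂ) = Complex.exp ((Complex.arg a : ℂ) * Complex.I) := by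
  have h := Complex.norm_mul_exp_arg_mul_I a
  have hn : ((‖a‖ : ℝ) : ℂ) ≠ 0 := by exact_mod_cast (norm_ne_zero_iff.2 ha)
  rw [div_eq_iff hn, mul_comm, h]

/-- **The collar push with its swept angles.**  The collar push `κ` of `exists_collar_flow`
(time `1/20` of the flow) together with, for every hole `c_l`, a smooth rotation-invariant real
function `SW_l` on a neighbourhood of `D_k` lifting the angle swept about `c_l` by the planar shadow
of the orbit: `u(z(κ x) - c_l) = e^{i SW_l(x)} u(z(x) - c_l)` on `D_k` (`u(v) = v/|v|`).  The lift is the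
sum of the principal arguments of the ratios of consecutive shadows along a subdivision of the orbit
so fine that consecutive shadows are closer than `1/2 < |z - c_l|` (velocity bound times time step),
which keeps every ratio in the right half-plane, where the argument is smooth. [folklore] -/
theorem exists_collar_phase (k : ℕ) {U : Set (EuclideanSpace ℝ (Fin 4))} (hUo : IsOpen U)
    (hDU : modelHandlebody k ⊆ U) :
    ∃ (κ : EuclideanSpace ℝ (Fin 4) ≃ₘ⟮𝓡 4, 𝓡 4⟯ EuclideanSpace ℝ (Fin 4))
      (K N₀ : Set (EuclideanSpace ℝ (Fin 4))) (SW : Fin k → EuclideanSpace ℝ (Fin 4) → ℝ),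
      IsCompact K ∧ K ⊆ U ∧ (∀ x, x ∉ K → κ x = x) ∧
      (∀ x ∈ modelHandlebody k, κ x ∈ modelHandlebody k ∧ levelFun k (κ x) ≤ 24 / 25) ∧
      (∀ u : ℂ, ‖u‖ = 1 → ∀ x, κ (fibreRot (fun _ => u) x) = fibreRot (fun _ => u) (κ x)) ∧
      IsOpen N₀ ∧ modelHandlebody k ⊆ N₀ ∧ (∀ l, ContDiffOn ℝ ∞ (SW l) N₀) ∧
      (∀ l (u : ℂ), ‖u‖ = 1 → ∀ x, SW l (fibreRot (fun _ => u) x) = SW l x) ∧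
      ∀ l, ∀ x ∈ modelHandlebody k,
        (zC (κ x) - holeCentre k l) / ((‖zC (κ x) - holeCentre k l‖ : ℝ) : ℂ) =
          Complex.exp ((SW l x : ℂ) * Complex.I) *
            ((zC x - holeCentre k l) / ((‖zC x - holeCentre k l‖ : ℝ) : ℂ)) := by
  obtain ⟨θ, V, K, hθs, h0, hadd, hint, hVc, hKc, hKU, hVK, hfixK, hstage, hcomm, horbK, hKg, hDK,
    horbit⟩ := exists_collar_flow k hUo hDU
  -- velocity bound
  obtain ⟨M, hM0, hM⟩ : ∃ M : ℝ, 0 < M ∧ ∀ y, ‖V y‖ ≤ M := by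
    obtain ⟨C, hC⟩ := hKc.exists_bound_of_continuousOn hVc.continuousOn
    refine ⟨max C 0 + 1, by positivity, fun y => ?_⟩
    by_cases hy : y ∈ K
    · exact (hC y hy).trans (by linarith [le_max_left C 0])
    · rw [hVK y hy, norm_zero]; positivity
  -- the subdivision
  obtain ⟨n, hn⟩ := exists_nat_ge (M / 10 + 1)
  have hn1 : (1 : ℝ) ≤ n := le_trans (by linarith [div_nonneg hM0.le (by norm_num : (0:ℝ) ≤ 10)]) hn
  have hn0 : (n : ℝ) ≠ 0 := by positivity
  have hstep : M / (20 * (n : ℝ)) ≤ 1 / 2 := by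
    rw [div_le_iff₀ (by positivity)]; nlinarith
  set t : ℕ → ℝ := fun i => (i : ℝ) / (20 * n) with ht
  have ht0 : t 0 = 0 := by simp [ht]
  have htn : t n = 1 / 20 := by simp only [ht]; field_simp
  have htmono : ∀ i, t i ≤ t (i + 1) := fun i => by
    simp only [ht]; gcongr; linarith
  have htdiff : ∀ i, t (i + 1) - t i = 1 / (20 * n) := fun i => by
    simp only [ht]; push_cast; field_simp; ring
  set Z : ℕ → EuclideanSpace ℝ (Fin 4) → ℂ := fun i x => zC (θ (t i, x)) with hZ
  -- displacement along one step
  have hdisp : ∀ x i, ‖Z (i + 1) x - Z i x‖ ≤ 1 / 2 := by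
    intro x i
    have hseg : ∀ s ∈ Icc (t i) (t (i + 1)), HasDerivWithinAt (fun s => θ (s, x)) (V (θ (s, x)))
        (Icc (t i) (t (i + 1))) s := fun s _ => (hint x s).hasDerivWithinAt
    have h := norm_image_sub_le_of_norm_deriv_le_segment' hseg (fun s _ => hM _) (t (i + 1))
      ⟨htmono i, le_rfl⟩
    rw [htdiff] at h
    calc ‖Z (i + 1) x - Z i x‖ ≤ ‖θ (t (i + 1), x) - θ (t i, x)‖ := norm_zC_sub_le _ _
      _ ≤ M * (1 / (20 * n)) := h
      _ = M / (20 * n) := by ring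
      _ ≤ 1 / 2 := hstep
  -- the good set
  set N₀ : Set (EuclideanSpace ℝ (Fin 4)) := {x | ∀ l : Fin k, ∀ i ∈ Finset.range n,
    Z i x - holeCentre k l ≠ 0 ∧ 0 < ((Z (i + 1) x - holeCentre k l) / (Z i x - holeCentre k l)).re}
    with hN₀
  have hZs : ∀ i, ContDiff ℝ ∞ (Z i) := fun i =>
    contDiff_zC.comp (hθs.comp (contDiff_const.prodMk contDiff_id))
  have hN₀o : IsOpen N₀ := by
    have : N₀ = ⋂ l : Fin k, ⋂ i ∈ Finset.range n, ({x | Z i x - holeCentre k l ≠ 0} ∩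
        (fun x => (Z (i + 1) x - holeCentre k l) / (Z i x - holeCentre k l)) ⁻¹' {q | 0 < q.re}) := by
      ext x; simp only [hN₀, mem_setOf_eq, mem_iInter, mem_inter_iff, mem_preimage]
    rw [this]
    refine isOpen_iInter_of_finite fun l => isOpen_biInter_finset fun i _ => ?_
    have hO : IsOpen {x : EuclideanSpace ℝ (Fin 4) | Z i x - holeCentre k l ≠ 0} :=
      isOpen_ne_fun ((hZs i).continuous.sub continuous_const) continuous_const
    refine ContinuousOn.isOpen_inter_preimage ?_ hO (isOpen_lt continuous_const Complex.continuous_re)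
    exact ((hZs (i + 1)).continuous.sub continuous_const).continuousOn.div
      ((hZs i).continuous.sub continuous_const).continuousOn fun x hx => hx
  -- `D_k ⊆ N₀`
  have hfar : ∀ x ∈ modelHandlebody k, ∀ i (l : Fin k), Real.sqrt (1 / 2) ≤ ‖Z i x - holeCentre k l‖ := by
    intro x hx i l
    have hK' : θ (t i, x) ∈ K := horbK x (hDK hx) _
    have h := hKg _ hK' l
    rw [holeTerm_eq_normSq, Complex.normSq_eq_norm_sq] at h
    exact Real.sqrt_le_iff.2 ⟨norm_nonneg _, h⟩
  have hsqrt : (1 : ℝ) / 2 < Real.sqrt (1 / 2) := by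
    rw [show (1 : ℝ) / 2 = Real.sqrt ((1 / 2) ^ 2) by rw [Real.sqrt_sq]; norm_num]
    exact Real.sqrt_lt_sqrt (by norm_num) (by norm_num)
  have hDN : modelHandlebody k ⊆ N₀ := by
    intro x hx l i _
    have hz : Z i x - holeCentre k l ≠ 0 := fun h => by
      have := hfar x hx i l; rw [h, norm_zero] at this; linarith [Real.sqrt_nonneg (1 / 2)]
    refine ⟨hz, ?_⟩
    have hq : ‖(Z (i + 1) x - Z i x) / (Z i x - holeCentre k l)‖ < 1 := by
      rw [norm_div, div_lt_one (norm_pos_iff.2 hz)]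
      linarith [hdisp x i, hfar x hx i l]
    have heq : (Z (i + 1) x - holeCentre k l) / (Z i x - holeCentre k l) =
        1 + (Z (i + 1) x - Z i x) / (Z i x - holeCentre k l) := by
      field_simp; ring
    rw [heq, Complex.add_re, Complex.one_re]
    have := Complex.abs_re_le_norm ((Z (i + 1) x - Z i x) / (Z i x - holeCentre k l))
    linarith [neg_abs_le ((Z (i + 1) x - Z i x) / (Z i x - holeCentre k l)).re]
  -- the swept angles
  set SW : Fin k → EuclideanSpace ℝ (Fin 4) → ℝ := fun l x =>
    ∑ i ∈ Finset.range n, Complex.arg ((Z (i + 1) x - holeCentre k l) / (Z i x - holeCentre k l))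
    with hSW
  have hSWs : ∀ l, ContDiffOn ℝ ∞ (SW l) N₀ := by
    intro l x hx
    refine ContDiffWithinAt.mono_of_mem_nhdsWithin (s := univ) ?_ (by simp)
    rw [contDiffWithinAt_univ]
    refine ContDiffAt.sum fun i hi => ?_
    obtain ⟨hz, hre⟩ := hx l i hi
    have hR : ContDiffAt ℝ ∞ (fun x => (Z (i + 1) x - holeCentre k l) / (Z i x - holeCentre k l)) x := by
      simp only [div_eq_mul_inv]
      exact (((hZs (i + 1)).sub contDiff_const).contDiffAt).mul
        ((((hZs i).sub contDiff_const).contDiffAt).inv hz)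
    exact (contDiffAt_arg (Or.inl hre)).comp x hR
  -- invariance
  have hZrot : ∀ (u : ℂ), ‖u‖ = 1 → ∀ i x, Z i (fibreRot (fun _ => u) x) = Z i x := by
    intro u hu i x
    simp only [hZ, hcomm u hu, zC_fibreRot]
  have hSWrot : ∀ l (u : ℂ), ‖u‖ = 1 → ∀ x, SW l (fibreRot (fun _ => u) x) = SW l x := by
    intro l u hu x
    simp only [hSW, hZrot u hu]
  -- the telescoping identity
  have htel : ∀ l, ∀ x ∈ modelHandlebody k, ∀ i, i ≤ n →
      (Z i x - holeCentre k l) / ((‖Z i x - holeCentre k l‖ : ℝ) : ℂ) =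
        Complex.exp (((∑ i' ∈ Finset.range i, Complex.arg ((Z (i' + 1) x - holeCentre k l) /
          (Z i' x - holeCentre k l)) : ℝ) : ℂ) * Complex.I) *
          ((Z 0 x - holeCentre k l) / ((‖Z 0 x - holeCentre k l‖ : ℝ) : ℂ)) := by
    intro l x hx i hi
    induction i with
    | zero => simp
    | succ i ih =>
      have hz : Z i x - holeCentre k l ≠ 0 := fun h => by
        have := hfar x hx i l; rw [h, norm_zero] at this; linarith [Real.sqrt_nonneg (1 / 2)]
      have hz' : Z (i + 1) x - holeCentre k l ≠ 0 := fun h => by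
        have := hfar x hx (i + 1) l; rw [h, norm_zero] at this; linarith [Real.sqrt_nonneg (1 / 2)]
      have hRne : (Z (i + 1) x - holeCentre k l) / (Z i x - holeCentre k l) ≠ 0 := div_ne_zero hz' hz
      have hfac : Z (i + 1) x - holeCentre k l =
          (Z (i + 1) x - holeCentre k l) / (Z i x - holeCentre k l) * (Z i x - holeCentre k l) := by
        rw [div_mul_cancel₀ _ hz]
      rw [hfac, unit_mul, ih (Nat.le_of_succ_le hi), unit_eq_exp_arg hRne, Finset.sum_range_succ]
      push_cast
      rw [add_mul, Complex.exp_add]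
      ring
  -- the stage
  obtain ⟨Φ, hΦ⟩ := hstage (1 / 20)
  refine ⟨Φ, K, N₀, SW, hKc, hKU, fun x hx => ?_, fun x hx => ?_, fun u hu x => ?_, hN₀o, hDN, hSWs,
    hSWrot, fun l x hx => ?_⟩
  · rw [hΦ]; exact hfixK x hx _
  · rw [hΦ]; exact horbit x hx
  · rw [hΦ, hΦ]; exact hcomm u hu _ _
  · have h := htel l x hx n le_rfl
    have hZn : Z n x = zC (Φ x) := by simp only [hZ, htn, hΦ]
    have hZ0 : Z 0 x = zC x := by simp only [hZ, ht0, h0]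
    rw [hZn, hZ0] at h
    exact h


end ModelHandles

/-- **Registered piece `helper_handlebodyChart_modelHandles_collarPhase` of the model lemma M3 (the
collar push with its swept angles)**: the collar push of `D_k` into `D_k ∩ {G_k ≤ 24/25}` supported in
a given open `U ⊇ D_k`, equivariant under the rotations of the `w`-plane, together with smooth invariant
lifts near `D_k` of the angles swept about the hole centres (`ModelHandles.exists_collar_phase`).
[cite: Milnor1963, Thm. 3.1] -/
theorem helper_handlebodyChart_modelHandles_collarPhase : ∀ (k : ℕ) (U : Set (EuclideanSpace ℝ (Fin 4))), IsOpen U → Literature.Topology.FourManifolds.MMSW.modelHandlebody k ⊆ U → ∃ (κ : EuclideanSpace ℝ (Fin 4) ≃ₘ⟮𝓡 4, 𝓡 4⟯ EuclideanSpace ℝ (Fin 4)) (K N₀ : Set (EuclideanSpace ℝ (Fin 4))) (SW : Fin k → EuclideanSpace ℝ (Fin 4) → ℝ), IsCompact K ∧ K ⊆ U ∧ (∀ x, x ∉ K → κ x = x) ∧ (∀ x ∈ Literature.Topology.FourManifolds.MMSW.modelHandlebody k, κ x ∈ Literature.Topology.FourManifolds.MMSW.modelHandlebody k ∧ Literature.Topology.FourManifolds.MMSW.levelFun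 k (κ x) ≤ 24 / 25) ∧ (∀ u : ℂ, ‖u‖ = 1 → ∀ x, κ (Literature.Topology.FourManifolds.MMSW.fibreRot (fun _ => u) x) = Literature.Topology.FourManifolds.MMSW.fibreRot (fun _ => u) (κ x)) ∧ IsOpen N₀ ∧ Literature.Topology.FourManifolds.MMSW.modelHandlebody k ⊆ N₀ ∧ (∀ l, ContDiffOn ℝ ((⊤ : ℕ∞) : WithTop ℕ∞) (SW l) N₀) ∧ (∀ l (u : ℂ), ‖u‖ = 1 → ∀ x, SW l (Literature.Topology.FourManifolds.MMSW.fibreRot (fun _ => u) x) = SW l x) ∧ ∀ l, ∀ x ∈ Literature.Topology.FourManifolds.MMSW.modelHandlebody k, (Literature.AlgebraicTopology.Homotopy.HopfFibration.zC (κ x) - Literature.Topology.FourManifolds.MMSW.holeCentre k l) / ((‖Literature.AlgebraicTopology.Homotopy.HopfFibration.zC (κ x) - Literature.Topology.FourManifolds.MMSW.holeCentre k l‖ : ℝ) : ℂ) = Complex.exp ((SW l x : ℂ) * Complex.I) * ((Literature.AlgebraicTopology.Homotopy.HopfFibration.zC x - Literature.Topology.FourManifolds.MMSW.holeCentre k l)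 / ((‖Literature.AlgebraicTopology.Homotopy.HopfFibration.zC x - Literature.Topology.FourManifolds.MMSW.holeCentre k l‖ : ℝ) : ℂ)) :=
  fun k _ hUo hDU => ModelHandles.exists_collar_phase k hUo hDU

end Summit.SmoothPoincare4.SmoothPoincare4.Theorems.DcrGap.MkFriends

end
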